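import Literature.Geometry.Kaehler.HodgeRiemannPointwiseFrame
import HarnessLib

/-!
# Pointwise Hodge–Riemann, II: splitting off one complex line — the decomposition of a form

Topic `Literature/Geometry/Kaehler`. Second file of the pointwise Hodge–Riemann bilinear relation
(Huybrechts (2005), Cor. 1.2.36; Voisin (2002), Thm. 6.32 at a point), in the graded-form calculus.
For a unit vector `x` of a real inner product space with isometric complex structure `J` (so that
`x, Jx` is an orthonormal pair, with dual covectors `θ_x = ⟪x, ·⟫`, `θ_y = ⟪Jx, ·⟫` and complex
covectors `ζ = θ_x + iθ_y`, `ζ̄ = θ_x - iθ_y`) every graded form `α` splits uniquely as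

  `α = a + ζ ∧ b + ζ̄ ∧ c + θ_x ∧ θ_y ∧ d`   with `a, b, c, d` *horizontal* (`x ⌟`, `Jx ⌟` kill them):

`d = Jx ⌟ x ⌟ α`, `e = x ⌟ α - θ_y ∧ d`, `f = Jx ⌟ α + θ_x ∧ d`, `a = α - θ_x ∧ e - θ_y ∧ f - θ_x ∧ θ_y ∧ d`,
`b = ½(e - i f)`, `c = ½(e + i f)` (`compD`, `compE`, `compF`, `compA`, `compB`, `compC`). We prove the
decomposition (`decomposition_eq`), horizontality, **uniqueness** (`eq_zero_of_decomposition_eq_zero`: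
`A + ζ ∧ B + ζ̄ ∧ C + θ_xθ_y ∧ D = 0` with horizontal `A, B, C, D` forces all four to vanish), and the
bookkeeping of supports (in a unitary frame, for `x = u_n`: the components of a form supported in
`S` are supported in `S.erase n`), degrees and **weights** (`b` has weight `w - 1`, `c` weight
`w + 1`, `a, d` weight `w` when `α` has weight `w`: the components of a `(p,q)`-form have types
`(p,q), (p-1,q), (p,q-1), (p-1,q-1)`). Finally the **primitivity transfer**
(`primitive_components`): if `L_S^{r+1} α = 0` for `S = insert n S'` then, with `L' = L_{S'}`,
`L'^{r+1} b = L'^{r+1} c = 0`, `L'^{r+1} a = 0` and `L'^{r+1} d + (r+1) L'^r a = 0`, whence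
`a₀ = a + (r+1)⁻¹ L' d` satisfies `L'^r a₀ = 0` and `L'^{r+2} d = 0` (the step of the induction on
the dimension in the proof of the Hodge–Riemann relation, file III).

Everything is proved; the only definitions are the six components, the Lefschetz operator of the
coframe `frameLef` and the two complex wedges `zetaWedgeG`, `zetaBarWedgeG`.

## References

* D. Huybrechts, *Complex Geometry. An Introduction* (2005), §1.2, Prop. 1.2.30, Cor. 1.2.36.
  [Huybrechts2005]
* C. Voisin, *Hodge Theory and Complex Algebraic Geometry I*, CUP (2002), §6.2.1, §6.3.2. [Voisin2002]
-/

noncomputable section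

open Module Submodule ContinuousAlternatingMap Function Finset
open scoped InnerProductSpace
open Literature.LinearAlgebra.Alternating Literature.LinearAlgebra.Alternating.GForm

namespace Literature.Geometry.Kaehler

section Decomposition

variable {V : Type*} [NormedAddCommGroup V] [InnerProductSpace ℝ V]
  (J : V →L[ℝ] V) (hJJ : ∀ v, J (J v) = -v) (hJ : ∀ v w, ⟪J v, J w⟫_ℝ = ⟪v, w⟫_ℝ)
  {F : Type*} [NormedAddCommGroup F] [NormedSpace ℝ F]

/-! ### The Lefschetz operator of the coframe; the complex covectors -/

/-- **The partial Lefschetz operator of a unitary coframe**: `L_S = ∑_{a ∈ S} θₐ ∧ θ'ₐ ∧ ·`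
(`= ω_S ∧ ·` for the partial Kähler form `ω_S = ∑_{a ∈ S} θₐ ∧ θ'ₐ`; for `S = univ`, `ω ∧ ·`,
`kaehlerTwoForm_eq_sum_wedgeOne`). [cite: Voisin2002, §6.2.1] -/
def frameLef {d : ℕ} (u : Fin d → V) (S : Finset (Fin d)) : Module.End ℝ (GForm V F) :=
  lefG (fun a ↦ innerSL ℝ (u a)) (fun a ↦ innerSL ℝ (J (u a))) S

/-- **Wedge with the `(1,0)`-covector `ζ_x = θ_x + iθ_{Jx}`.** [cite: Voisin2002, §2.3.1] -/
def zetaWedgeG (x : V) (w : GForm V ℂ) : GForm V ℂ :=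
  wedgeOneG (innerSL ℝ x) w + Complex.I • wedgeOneG (innerSL ℝ (J x)) w

/-- **Wedge with the `(0,1)`-covector `ζ̄_x = θ_x - iθ_{Jx}`.** [cite: Voisin2002, §2.3.1] -/
def zetaBarWedgeG (x : V) (w : GForm V ℂ) : GForm V ℂ :=
  wedgeOneG (innerSL ℝ x) w - Complex.I • wedgeOneG (innerSL ℝ (J x)) w

/-- Unfolding of `zetaWedgeG`. [folklore] -/
theorem zetaWedgeG_def (x : V) (w : GForm V ℂ) :
    zetaWedgeG J x w = wedgeOneG (innerSL ℝ x) w + Complex.I • wedgeOneG (innerSL ℝ (J x)) w := rfl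

/-- Unfolding of `zetaBarWedgeG`. [folklore] -/
theorem zetaBarWedgeG_def (x : V) (w : GForm V ℂ) :
    zetaBarWedgeG J x w = wedgeOneG (innerSL ℝ x) w - Complex.I • wedgeOneG (innerSL ℝ (J x)) w := rfl

/-- `ζ ∧ ·` is additive. [folklore] -/
theorem zetaWedgeG_add (x : V) (w w' : GForm V ℂ) :
    zetaWedgeG J x (w + w') = zetaWedgeG J x w + zetaWedgeG J x w' := by
  simp only [zetaWedgeG_def, map_add, smul_add]; abel

/-- `ζ̄ ∧ ·` is additive. [folklore] -/
theorem zetaBarWedgeG_add (x : V) (w w' : GForm V ℂ) :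
    zetaBarWedgeG J x (w + w') = zetaBarWedgeG J x w + zetaBarWedgeG J x w' := by
  simp only [zetaBarWedgeG_def, map_add, smul_add]; abel

/-- `ζ ∧ ·` is `ℂ`-linear. [folklore] -/
theorem zetaWedgeG_smul (x : V) (c : ℂ) (w : GForm V ℂ) : zetaWedgeG J x (c • w) = c • zetaWedgeG J x w := by
  simp only [zetaWedgeG_def, wedgeOneG_smul_complex, smul_add, smul_comm c]

/-- `ζ̄ ∧ ·` is `ℂ`-linear. [folklore] -/
theorem zetaBarWedgeG_smul (x : V) (c : ℂ) (w : GForm V ℂ) :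
    zetaBarWedgeG J x (c • w) = c • zetaBarWedgeG J x w := by
  simp only [zetaBarWedgeG_def, wedgeOneG_smul_complex, smul_sub, smul_comm c]

/-- `ζ ∧ 0 = 0`. [folklore] -/
@[simp]
theorem zetaWedgeG_zero (x : V) : zetaWedgeG J x (0 : GForm V ℂ) = 0 := by
  simp only [zetaWedgeG_def, LinearMap.map_zero, smul_zero, add_zero]

/-- `ζ̄ ∧ 0 = 0`. [folklore] -/
@[simp]
theorem zetaBarWedgeG_zero (x : V) : zetaBarWedgeG J x (0 : GForm V ℂ) = 0 := by
  simp only [zetaBarWedgeG_def, LinearMap.map_zero, smul_zero, sub_zero]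

/-- `ζ ∧ (-w) = -(ζ ∧ w)`. [folklore] -/
theorem zetaWedgeG_neg (x : V) (w : GForm V ℂ) : zetaWedgeG J x (-w) = -zetaWedgeG J x w := by
  simp only [zetaWedgeG_def, map_neg, smul_neg, neg_add]

/-- `ζ̄ ∧ (-w) = -(ζ̄ ∧ w)`. [folklore] -/
theorem zetaBarWedgeG_neg (x : V) (w : GForm V ℂ) : zetaBarWedgeG J x (-w) = -zetaBarWedgeG J x w := by
  simp only [zetaBarWedgeG_def, map_neg, smul_neg, neg_sub', sub_neg_eq_add]

/-- Conjugation exchanges the two complex wedges: `conj (ζ ∧ w) = ζ̄ ∧ conj w`. [folklore] -/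
theorem conjG_zetaWedgeG (x : V) (w : GForm V ℂ) : conjG (zetaWedgeG J x w) = zetaBarWedgeG J x (conjG w) := by
  rw [zetaWedgeG_def, zetaBarWedgeG_def, conjG_add, conjG_smul, conjG_wedgeOneG, conjG_wedgeOneG,
    Complex.conj_I, neg_smul, ← sub_eq_add_neg]

/-- `conj (ζ̄ ∧ w) = ζ ∧ conj w`. [folklore] -/
theorem conjG_zetaBarWedgeG (x : V) (w : GForm V ℂ) :
    conjG (zetaBarWedgeG J x w) = zetaWedgeG J x (conjG w) := by
  rw [zetaWedgeG_def, zetaBarWedgeG_def, conjG_sub, conjG_smul, conjG_wedgeOneG, conjG_wedgeOneG,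
    Complex.conj_I, neg_smul, sub_neg_eq_add]

/-- `ζ ∧ ζ ∧ w = 0`. [cite: Voisin2002, §2.3.1] -/
theorem zetaWedgeG_zetaWedgeG (x : V) (w : GForm V ℂ) : zetaWedgeG J x (zetaWedgeG J x w) = 0 := by
  have h1 := wedgeOneG_wedgeOneG_self (F := ℂ) (innerSL ℝ x) w
  have h2 := wedgeOneG_wedgeOneG_self (F := ℂ) (innerSL ℝ (J x)) w
  have h3 := wedgeOneG_wedgeOneG (F := ℂ) (innerSL ℝ (J x)) (innerSL ℝ x) w
  simp only [zetaWedgeG_def, map_add, wedgeOneG_smul_complex, h1, h2, h3, smul_zero, add_zero,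
    zero_add, smul_neg, add_neg_cancel]

/-- `ζ̄ ∧ ζ̄ ∧ w = 0`. [cite: Voisin2002, §2.3.1] -/
theorem zetaBarWedgeG_zetaBarWedgeG (x : V) (w : GForm V ℂ) :
    zetaBarWedgeG J x (zetaBarWedgeG J x w) = 0 := by
  have h1 := wedgeOneG_wedgeOneG_self (F := ℂ) (innerSL ℝ x) w
  have h2 := wedgeOneG_wedgeOneG_self (F := ℂ) (innerSL ℝ (J x)) w
  have h3 := wedgeOneG_wedgeOneG (F := ℂ) (innerSL ℝ (J x)) (innerSL ℝ x) w
  simp only [zetaBarWedgeG_def, map_sub, wedgeOneG_smul_complex, h1, h2, h3, smul_zero, sub_zero,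
    zero_sub, smul_neg, sub_self]

/-- **`ζ ∧ ζ̄ ∧ w = -2i θ_x ∧ θ_y ∧ w`** (`dz ∧ dz̄ = -2i dx ∧ dy`). [cite: Voisin2002, §3.1.1] -/
theorem zetaWedgeG_zetaBarWedgeG (x : V) (w : GForm V ℂ) :
    zetaWedgeG J x (zetaBarWedgeG J x w) =
      (-2 * Complex.I) • wedgeOneG (innerSL ℝ x) (wedgeOneG (innerSL ℝ (J x)) w) := by
  have h1 := wedgeOneG_wedgeOneG_self (F := ℂ) (innerSL ℝ x) w
  have h2 := wedgeOneG_wedgeOneG_self (F := ℂ) (innerSL ℝ (J x)) w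
  have h3 := wedgeOneG_wedgeOneG (F := ℂ) (innerSL ℝ (J x)) (innerSL ℝ x) w
  simp only [zetaWedgeG_def, zetaBarWedgeG_def, map_sub, wedgeOneG_smul_complex, h1, h2, h3, smul_zero,
    sub_zero, zero_sub, smul_neg]
  module

/-- **`ζ̄ ∧ ζ ∧ w = 2i θ_x ∧ θ_y ∧ w`.** [cite: Voisin2002, §3.1.1] -/
theorem zetaBarWedgeG_zetaWedgeG (x : V) (w : GForm V ℂ) :
    zetaBarWedgeG J x (zetaWedgeG J x w) =
      (2 * Complex.I) • wedgeOneG (innerSL ℝ x) (wedgeOneG (innerSL ℝ (J x)) w) := by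
  have h1 := wedgeOneG_wedgeOneG_self (F := ℂ) (innerSL ℝ x) w
  have h2 := wedgeOneG_wedgeOneG_self (F := ℂ) (innerSL ℝ (J x)) w
  have h3 := wedgeOneG_wedgeOneG (F := ℂ) (innerSL ℝ (J x)) (innerSL ℝ x) w
  simp only [zetaWedgeG_def, zetaBarWedgeG_def, map_add, wedgeOneG_smul_complex, h1, h2, h3, smul_zero,
    add_zero, zero_add, smul_neg]
  module

/-- `θ_x ∧ θ_y ∧ w = (i/2) ζ ∧ ζ̄ ∧ w`. [cite: Voisin2002, §3.1.1] -/
theorem wedgeOneG_wedgeOneG_eq_zeta (x : V) (w : GForm V ℂ) :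
    wedgeOneG (innerSL ℝ x) (wedgeOneG (innerSL ℝ (J x)) w) =
      (2⁻¹ * Complex.I) • zetaWedgeG J x (zetaBarWedgeG J x w) := by
  rw [zetaWedgeG_zetaBarWedgeG, smul_smul]
  have : (2⁻¹ * Complex.I) * (-2 * Complex.I) = 1 := by
    rw [show (2⁻¹ * Complex.I) * (-2 * Complex.I) = -(Complex.I * Complex.I) by ring, Complex.I_mul_I, neg_neg]
  rw [this, one_smul]

/-! ### The components -/

/-- `d = Jx ⌟ x ⌟ α`. [cite: Huybrechts2005, §1.2] -/
def compD (x : V) (α : GForm V F) : GForm V F := curryLeftG (J x) (curryLeftG x α)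

/-- `e = x ⌟ α - θ_y ∧ d`. [cite: Huybrechts2005, §1.2] -/
def compE (x : V) (α : GForm V F) : GForm V F := curryLeftG x α - wedgeOneG (innerSL ℝ (J x)) (compD J x α)

/-- `f = Jx ⌟ α + θ_x ∧ d`. [cite: Huybrechts2005, §1.2] -/
def compF (x : V) (α : GForm V F) : GForm V F := curryLeftG (J x) α + wedgeOneG (innerSL ℝ x) (compD J x α)

/-- `a = α - θ_x ∧ e - θ_y ∧ f - θ_x ∧ θ_y ∧ d` (the horizontal part). [cite: Huybrechts2005, §1.2] -/
def compA (x : V) (α : GForm V F) : GForm V F :=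
  α - wedgeOneG (innerSL ℝ x) (compE J x α) - wedgeOneG (innerSL ℝ (J x)) (compF J x α) -
    wedgeOneG (innerSL ℝ x) (wedgeOneG (innerSL ℝ (J x)) (compD J x α))

/-- `b = ½(e - i f)` (so that `θ_x ∧ e + θ_y ∧ f = ζ ∧ b + ζ̄ ∧ c`). [cite: Huybrechts2005, §1.2] -/
def compB (x : V) (α : GForm V ℂ) : GForm V ℂ := (2⁻¹ : ℂ) • (compE J x α - Complex.I • compF J x α)

/-- `c = ½(e + i f)`. [cite: Huybrechts2005, §1.2] -/
def compC (x : V) (α : GForm V ℂ) : GForm V ℂ := (2⁻¹ : ℂ) • (compE J x α + Complex.I • compF J x α)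

/-- **The decomposition, real form**: `α = a + θ_x ∧ e + θ_y ∧ f + θ_x ∧ θ_y ∧ d` (by definition of
`a`). [cite: Huybrechts2005, §1.2] -/
theorem decomposition_real (x : V) (α : GForm V F) :
    α = compA J x α + wedgeOneG (innerSL ℝ x) (compE J x α) + wedgeOneG (innerSL ℝ (J x)) (compF J x α) +
      wedgeOneG (innerSL ℝ x) (wedgeOneG (innerSL ℝ (J x)) (compD J x α)) := by
  simp only [compA]; abel

/-- `θ_x ∧ e + θ_y ∧ f = ζ ∧ b + ζ̄ ∧ c`. [folklore] -/
theorem wedgeOneG_compE_add (x : V) (α : GForm V ℂ) :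
    wedgeOneG (innerSL ℝ x) (compE J x α) + wedgeOneG (innerSL ℝ (J x)) (compF J x α) =
      zetaWedgeG J x (compB J x α) + zetaBarWedgeG J x (compC J x α) := by
  rw [compB, compC, zetaWedgeG_smul, zetaBarWedgeG_smul, zetaWedgeG_def, zetaBarWedgeG_def]
  set E := compE J x α
  set G := compF J x α
  have hI : ∀ z : GForm V ℂ, Complex.I • Complex.I • z = -z := I_smul_I_smul
  simp only [map_sub, map_add, wedgeOneG_smul_complex, smul_sub, smul_add, hI]
  module

/-- **The decomposition** `α = a + ζ ∧ b + ζ̄ ∧ c + θ_x ∧ θ_y ∧ d`. [cite: Huybrechts2005, §1.2] -/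
theorem decomposition_eq (x : V) (α : GForm V ℂ) :
    α = compA J x α + zetaWedgeG J x (compB J x α) + zetaBarWedgeG J x (compC J x α) +
      wedgeOneG (innerSL ℝ x) (wedgeOneG (innerSL ℝ (J x)) (compD J x α)) := by
  conv_lhs => rw [decomposition_real J x α]
  rw [add_assoc (compA J x α), wedgeOneG_compE_add, ← add_assoc]

/-! ### Horizontality of the components -/

section Horizontal

variable {J} {x : V}

/-- `x ⌟ d = 0`. [folklore] -/
theorem curryLeftG_compD (x : V) (α : GForm V F) : curryLeftG x (compD J x α) = 0 := by
  rw [compD, curryLeftG_curryLeftG, curryLeftG_curryLeftG_self, LinearMap.map_zero, neg_zero]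

/-- `Jx ⌟ d = 0`. [folklore] -/
theorem curryLeftG_J_compD (x : V) (α : GForm V F) : curryLeftG (J x) (compD J x α) = 0 := by
  rw [compD, curryLeftG_curryLeftG_self]

variable (h1x : innerSL ℝ x x = 1) (h0x : innerSL ℝ x (J x) = 0) (h0y : innerSL ℝ (J x) x = 0)
  (h1y : innerSL ℝ (J x) (J x) = 1)

include h0y in
/-- `x ⌟ e = 0`. [folklore] -/
theorem curryLeftG_compE (α : GForm V F) : curryLeftG x (compE J x α) = 0 := by
  simp only [compE, map_sub, curryLeftG_curryLeftG_self, curryLeftG_wedgeOneG, h0y, zero_smul, curryLeftG_compD,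
    LinearMap.map_zero, sub_zero]

include h1y in
/-- `Jx ⌟ e = 0`. [folklore] -/
theorem curryLeftG_J_compE (α : GForm V F) : curryLeftG (J x) (compE J x α) = 0 := by
  simp only [compE, map_sub, curryLeftG_wedgeOneG, h1y, one_smul, curryLeftG_J_compD, LinearMap.map_zero, sub_zero]
  rw [compD, sub_self]

include h1x in
/-- `x ⌟ f = 0`. [folklore] -/
theorem curryLeftG_compF (α : GForm V F) : curryLeftG x (compF J x α) = 0 := by
  simp only [compF, map_add, curryLeftG_wedgeOneG, h1x, one_smul, curryLeftG_compD, LinearMap.map_zero, sub_zero]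
  rw [compD, curryLeftG_curryLeftG, neg_add_cancel]

include h0x in
/-- `Jx ⌟ f = 0`. [folklore] -/
theorem curryLeftG_J_compF (α : GForm V F) : curryLeftG (J x) (compF J x α) = 0 := by
  simp only [compF, map_add, curryLeftG_curryLeftG_self, curryLeftG_wedgeOneG, h0x, zero_smul, curryLeftG_J_compD,
    LinearMap.map_zero, sub_zero, add_zero]

include h1x h0y in
/-- `x ⌟ a = 0`. [folklore] -/
theorem curryLeftG_compA (α : GForm V F) : curryLeftG x (compA J x α) = 0 := by
  have hE := curryLeftG_compE (J := J) (F := F) h0y α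
  have hF := curryLeftG_compF (J := J) (F := F) h1x α
  have hD := curryLeftG_compD (J := J) (F := F) x α
  simp only [compA, map_sub, curryLeftG_wedgeOneG, h1x, h0y, one_smul, zero_smul, hE, hF, hD, LinearMap.map_zero,
    sub_zero]
  rw [compE]; abel

include h0x h1y in
/-- `Jx ⌟ a = 0`. [folklore] -/
theorem curryLeftG_J_compA (α : GForm V F) : curryLeftG (J x) (compA J x α) = 0 := by
  have hE := curryLeftG_J_compE (J := J) (F := F) h1y α
  have hF := curryLeftG_J_compF (J := J) (F := F) h0x α
  have hD := curryLeftG_J_compD (J := J) (F := F) x α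
  simp only [compA, map_sub, curryLeftG_wedgeOneG, h0x, h1y, one_smul, zero_smul, hE, hF, hD, LinearMap.map_zero,
    sub_zero, zero_sub, sub_neg_eq_add]
  rw [compF]; abel

include h1x h0y in
/-- `x ⌟ b = 0`. [folklore] -/
theorem curryLeftG_compB (α : GForm V ℂ) : curryLeftG x (compB J x α) = 0 := by
  rw [compB, curryLeftG_smul_complex, map_sub, curryLeftG_smul_complex, curryLeftG_compE h0y, curryLeftG_compF h1x,
    smul_zero, sub_zero, smul_zero]

include h0x h1y in
/-- `Jx ⌟ b = 0`. [folklore] -/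
theorem curryLeftG_J_compB (α : GForm V ℂ) : curryLeftG (J x) (compB J x α) = 0 := by
  rw [compB, curryLeftG_smul_complex, map_sub, curryLeftG_smul_complex, curryLeftG_J_compE h1y,
    curryLeftG_J_compF h0x, smul_zero, sub_zero, smul_zero]

include h1x h0y in
/-- `x ⌟ c = 0`. [folklore] -/
theorem curryLeftG_compC (α : GForm V ℂ) : curryLeftG x (compC J x α) = 0 := by
  rw [compC, curryLeftG_smul_complex, map_add, curryLeftG_smul_complex, curryLeftG_compE h0y, curryLeftG_compF h1x,
    smul_zero, add_zero, smul_zero]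

include h0x h1y in
/-- `Jx ⌟ c = 0`. [folklore] -/
theorem curryLeftG_J_compC (α : GForm V ℂ) : curryLeftG (J x) (compC J x α) = 0 := by
  rw [compC, curryLeftG_smul_complex, map_add, curryLeftG_smul_complex, curryLeftG_J_compE h1y,
    curryLeftG_J_compF h0x, smul_zero, add_zero, smul_zero]

end Horizontal

include hJJ hJ in
/-- The four pairings of the coframe `θ_x, θ_y` with the frame `x, Jx` for a unit vector `x`.
[folklore] -/
theorem coframe_pairings {x : V} (hx : ⟪x, x⟫_ℝ = 1) (hxJ : ⟪x, J x⟫_ℝ = 0) :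
    innerSL ℝ x x = 1 ∧ innerSL ℝ x (J x) = 0 ∧ innerSL ℝ (J x) x = 0 ∧ innerSL ℝ (J x) (J x) = 1 := by
  refine ⟨by rw [innerSL_apply_apply, hx], by rw [innerSL_apply_apply, hxJ], ?_, by rw [innerSL_apply_apply, hJ, hx]⟩
  rw [innerSL_apply_apply, inner_J_left_eq_neg J hJJ hJ, hxJ, neg_zero]

/-! ### Uniqueness of the decomposition -/

/-- **Uniqueness**: if `A + ζ ∧ B + ζ̄ ∧ C + θ_x ∧ θ_y ∧ D = 0` with `A, B, C, D` killed by `x ⌟` and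
`Jx ⌟`, then `D = 0`, `B = 0`, `C = 0` and `A = 0` (contract with `Jx ⌟ x ⌟`, then with `x ⌟` and
`Jx ⌟`). [cite: Huybrechts2005, §1.2] -/
theorem eq_zero_of_decomposition_eq_zero (hJJ : ∀ v, J (J v) = -v) (hJ : ∀ v w, ⟪J v, J w⟫_ℝ = ⟪v, w⟫_ℝ) {x : V} (hx : ⟪x, x⟫_ℝ = 1) (hxJ : ⟪x, J x⟫_ℝ = 0)
    {A B C D : GForm V ℂ}
    (hAx : curryLeftG x A = 0) (hAy : curryLeftG (J x) A = 0) (hBx : curryLeftG x B = 0)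
    (hBy : curryLeftG (J x) B = 0)
    (hCx : curryLeftG x C = 0) (hCy : curryLeftG (J x) C = 0) (hDx : curryLeftG x D = 0) (hDy : curryLeftG (J x) D = 0)
    (h : A + zetaWedgeG J x B + zetaBarWedgeG J x C + wedgeOneG (innerSL ℝ x) (wedgeOneG (innerSL ℝ (J x)) D) = 0) :
    D = 0 ∧ B = 0 ∧ C = 0 ∧ A = 0 := by
  have h1x : innerSL ℝ x x = 1 := by rw [innerSL_apply_apply, hx]
  have h0x : innerSL ℝ x (J x) = 0 := by rw [innerSL_apply_apply, hxJ]
  have h0y : innerSL ℝ (J x) x = 0 := by rw [innerSL_apply_apply, inner_J_left_eq_neg J hJJ hJ, hxJ, neg_zero]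
  have h1y : innerSL ℝ (J x) (J x) = 1 := by rw [innerSL_apply_apply, hJ, hx]
  -- contractions of the four terms by `x`
  have cxB : curryLeftG x (zetaWedgeG J x B) = B := by
    simp only [zetaWedgeG_def, map_add, curryLeftG_smul_complex, curryLeftG_wedgeOneG, h1x, h0y, hBx, one_smul,
      zero_smul, LinearMap.map_zero, sub_zero, smul_zero, add_zero]
  have cxC : curryLeftG x (zetaBarWedgeG J x C) = C := by
    simp only [zetaBarWedgeG_def, map_sub, curryLeftG_smul_complex, curryLeftG_wedgeOneG, h1x, h0y, hCx, one_smul,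
      zero_smul, LinearMap.map_zero, sub_zero, smul_zero]
  have cxD : curryLeftG x (wedgeOneG (innerSL ℝ x) (wedgeOneG (innerSL ℝ (J x)) D)) = wedgeOneG (innerSL ℝ (J x)) D := by
    simp only [curryLeftG_wedgeOneG, h1x, one_smul, h0y, zero_smul, hDx, LinearMap.map_zero, sub_zero]
  -- contractions by `Jx`
  have cyB : curryLeftG (J x) (zetaWedgeG J x B) = Complex.I • B := by
    simp only [zetaWedgeG_def, map_add, curryLeftG_smul_complex, curryLeftG_wedgeOneG, h0x, h1y, hBy, zero_smul,
      one_smul, LinearMap.map_zero, sub_zero, zero_add]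
  have cyC : curryLeftG (J x) (zetaBarWedgeG J x C) = -(Complex.I • C) := by
    simp only [zetaBarWedgeG_def, map_sub, curryLeftG_smul_complex, curryLeftG_wedgeOneG, h0x, h1y, hCy, zero_smul,
      one_smul, LinearMap.map_zero, sub_zero, zero_sub]
  have cyD : curryLeftG (J x) (wedgeOneG (innerSL ℝ x) (wedgeOneG (innerSL ℝ (J x)) D)) = -wedgeOneG (innerSL ℝ x) D := by
    simp only [curryLeftG_wedgeOneG, h0x, zero_smul, h1y, one_smul, hDy, LinearMap.map_zero, sub_zero, zero_sub]
  -- `D = 0` from `Jx ⌟ x ⌟`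
  have hD : D = 0 := by
    have := congrArg (fun z ↦ curryLeftG (J x) (curryLeftG x z)) h
    simp only [map_add, LinearMap.map_zero, hAx, cxB, cxC, cxD, hBy, hCy, curryLeftG_wedgeOneG, h1y, one_smul, hDy,
      sub_zero, zero_add] at this
    exact this
  -- `B + C = 0` from `x ⌟`, `i B - i C = 0` from `Jx ⌟`
  have hBC : B + C = 0 := by
    have := congrArg (fun z ↦ curryLeftG x z) h
    simp only [map_add, LinearMap.map_zero, hAx, cxB, cxC, hD, zero_add, add_zero] at this
    exact this
  have hBC' : Complex.I • B - Complex.I • C = 0 := by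
    have := congrArg (fun z ↦ curryLeftG (J x) z) h
    simp only [map_add, LinearMap.map_zero, hAy, cyB, cyC, hD, add_zero, zero_add, ← sub_eq_add_neg] at this
    exact this
  have hBeqC : B = C := by
    rw [← smul_sub, smul_eq_zero] at hBC'
    exact sub_eq_zero.1 (hBC'.resolve_left Complex.I_ne_zero)
  have hB : B = 0 := by
    rw [← hBeqC, ← two_smul ℂ, smul_eq_zero] at hBC
    exact hBC.resolve_left two_ne_zero
  have hC : C = 0 := hBeqC ▸ hB
  refine ⟨hD, hB, hC, ?_⟩
  rwa [hB, hC, hD, zetaWedgeG_zero, zetaBarWedgeG_zero, LinearMap.map_zero, LinearMap.map_zero, add_zero,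
    add_zero, add_zero] at h

/-! ### Weights of the components -/

section Weights

variable {J} {x : V} {n : ℤ} {α : GForm V ℂ}

/-- `e - i f = (x ⌟ α - i Jx ⌟ α) - i ζ̄ ∧ d`. [folklore] -/
theorem compE_sub_I_compF (x : V) (α : GForm V ℂ) :
    compE J x α - Complex.I • compF J x α =
      (curryLeftG x α - Complex.I • curryLeftG (J x) α) - Complex.I • zetaBarWedgeG J x (compD J x α) := by
  have hI : ∀ z : GForm V ℂ, Complex.I • Complex.I • z = -z := I_smul_I_smul
  simp only [compE, compF, zetaBarWedgeG_def, smul_add, smul_sub, hI]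
  abel

/-- `e + i f = (x ⌟ α + i Jx ⌟ α) + i ζ ∧ d`. [folklore] -/
theorem compE_add_I_compF (x : V) (α : GForm V ℂ) :
    compE J x α + Complex.I • compF J x α =
      (curryLeftG x α + Complex.I • curryLeftG (J x) α) + Complex.I • zetaWedgeG J x (compD J x α) := by
  have hI : ∀ z : GForm V ℂ, Complex.I • Complex.I • z = -z := I_smul_I_smul
  simp only [compE, compF, zetaWedgeG_def, smul_add, hI]
  abel

/-- `d` has the weight of `α`. [cite: Voisin2002, §2.3.1] -/
theorem hasRotWeight_compD (hJJ : ∀ v, J (J v) = -v) (h : HasRotWeight J n α) (x : V) : HasRotWeight J n (compD J x α) :=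
  h.curryLeftG_curryLeftG hJJ x

/-- `x ⌟ α + i Jx ⌟ α` has weight `n + 1` (conjugate of `curryLeftG_zeta` for `conj α`). [cite: Voisin2002, §2.3.1] -/
theorem HasRotWeight.curryLeftG_zetaBar (hJJ : ∀ v, J (J v) = -v) (h : HasRotWeight J n α) (x : V) :
    HasRotWeight J (n + 1) (curryLeftG x α + Complex.I • curryLeftG (J x) α) := by
  have h1 := (h.conjG.curryLeftG_zeta hJJ x).conjG
  rw [conjG_sub, conjG_smul, Complex.conj_I, neg_smul, sub_neg_eq_add, ← conjG_curryLeftG, ← conjG_curryLeftG,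
    conjG_conjG, conjG_conjG, neg_sub, sub_neg_eq_add, add_comm (1 : ℤ) n] at h1
  exact h1

/-- **`b` has weight `n - 1`** (type `(p-1, q)`). [cite: Voisin2002, §2.3.1] -/
theorem hasRotWeight_compB (hJJ : ∀ v, J (J v) = -v) (hJ : ∀ v w, ⟪J v, J w⟫_ℝ = ⟪v, w⟫_ℝ)
    (h : HasRotWeight J n α) (x : V) : HasRotWeight J (n - 1) (compB J x α) := by
  rw [compB, compE_sub_I_compF]
  exact ((h.curryLeftG_zeta hJJ x).sub (((hasRotWeight_compD hJJ h x).zetaBar_wedge hJJ hJ x).smul Complex.I)).smul _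

/-- **`c` has weight `n + 1`** (type `(p, q-1)`). [cite: Voisin2002, §2.3.1] -/
theorem hasRotWeight_compC (hJJ : ∀ v, J (J v) = -v) (hJ : ∀ v w, ⟪J v, J w⟫_ℝ = ⟪v, w⟫_ℝ)
    (h : HasRotWeight J n α) (x : V) : HasRotWeight J (n + 1) (compC J x α) := by
  rw [compC, compE_add_I_compF]
  exact ((h.curryLeftG_zetaBar hJJ x).add (((hasRotWeight_compD hJJ h x).zeta_wedge hJJ hJ x).smul Complex.I)).smul _

/-- **`a` has weight `n`** (type `(p, q)`). [cite: Voisin2002, §2.3.1] -/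
theorem hasRotWeight_compA (hJJ : ∀ v, J (J v) = -v) (hJ : ∀ v w, ⟪J v, J w⟫_ℝ = ⟪v, w⟫_ℝ)
    (h : HasRotWeight J n α) (x : V) : HasRotWeight J n (compA J x α) := by
  have e : compA J x α = α - (zetaWedgeG J x (compB J x α) + zetaBarWedgeG J x (compC J x α)) -
      (2⁻¹ * Complex.I) • zetaWedgeG J x (zetaBarWedgeG J x (compD J x α)) := by
    rw [← wedgeOneG_compE_add, ← wedgeOneG_wedgeOneG_eq_zeta, compA]; abel
  rw [e]
  have hB := (hasRotWeight_compB hJJ hJ h x).zeta_wedge hJJ hJ x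
  have hC := (hasRotWeight_compC hJJ hJ h x).zetaBar_wedge hJJ hJ x
  have hD := (((hasRotWeight_compD hJJ h x).zetaBar_wedge hJJ hJ x).zeta_wedge hJJ hJ x).smul (2⁻¹ * Complex.I)
  rw [sub_add_cancel] at hB hD
  rw [add_sub_cancel_right] at hC
  rw [← zetaWedgeG_def] at hB hD
  rw [← zetaBarWedgeG_def] at hC hD
  exact (h.sub (hB.add hC)).sub hD

end Weights

/-! ### Degrees of the components -/

section Degrees

variable {J} {x : V} {α : GForm V F}

/-- `d` has degree `k` if `α` has degree `k + 2`. [folklore] -/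
theorem isHomog_compD {k : ℕ} (h : IsHomog (k + 2) α) (x : V) : IsHomog k (compD J x α) :=
  (h.curryLeftG x).curryLeftG (J x)

/-- `d = 0` if `α` has degree `0`. [folklore] -/
theorem compD_eq_zero_of_isHomog_zero (h : IsHomog 0 α) (x : V) : compD J x α = 0 := by
  rw [compD, h.curryLeftG_eq_zero, LinearMap.map_zero]

/-- `d = 0` if `α` has degree `1`. [folklore] -/
theorem compD_eq_zero_of_isHomog_one (h : IsHomog 1 α) (x : V) : compD J x α = 0 := by
  rw [compD]
  exact (h.curryLeftG x).curryLeftG_eq_zero (J x)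

/-- `e` has degree `k` if `α` has degree `k + 1`. [folklore] -/
theorem isHomog_compE : ∀ {k : ℕ} {α : GForm V F}, IsHomog (k + 1) α → ∀ x : V, IsHomog k (compE J x α)
  | 0, _, h, x => by
    rw [compE, compD_eq_zero_of_isHomog_one h, LinearMap.map_zero, sub_zero]; exact h.curryLeftG x
  | _ + 1, _, h, x => (h.curryLeftG x).sub ((isHomog_compD h x).wedgeOneG _)

/-- `f` has degree `k` if `α` has degree `k + 1`. [folklore] -/
theorem isHomog_compF : ∀ {k : ℕ} {α : GForm V F}, IsHomog (k + 1) α → ∀ x : V, IsHomog k (compF J x α)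
  | 0, _, h, x => by
    rw [compF, compD_eq_zero_of_isHomog_one h, LinearMap.map_zero, add_zero]; exact h.curryLeftG (J x)
  | _ + 1, _, h, x => (h.curryLeftG (J x)).add ((isHomog_compD h x).wedgeOneG _)

/-- `a` has the degree of `α`. [folklore] -/
theorem isHomog_compA : ∀ {k : ℕ} {α : GForm V F}, IsHomog k α → ∀ x : V, IsHomog k (compA J x α)
  | 0, α, h, x => by
    have hx : GForm.curryLeftG x α = 0 := h.curryLeftG_eq_zero x
    have hy : GForm.curryLeftG (J x) α = 0 := h.curryLeftG_eq_zero (J x)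
    have hD : compD J x α = 0 := compD_eq_zero_of_isHomog_zero h x
    have hE : compE J x α = 0 := by rw [compE, hD, hx, LinearMap.map_zero, sub_zero]
    have hF : compF J x α = 0 := by rw [compF, hD, hy, LinearMap.map_zero, add_zero]
    simp only [compA, hE, hF, hD, LinearMap.map_zero, sub_zero]
    exact h
  | 1, _, h, x => by
    rw [compA, compD_eq_zero_of_isHomog_one h, LinearMap.map_zero, LinearMap.map_zero, sub_zero]
    exact (h.sub ((isHomog_compE h x).wedgeOneG _)).sub ((isHomog_compF h x).wedgeOneG _)
  | _ + 2, _, h, x =>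
    ((h.sub ((isHomog_compE h x).wedgeOneG _)).sub ((isHomog_compF h x).wedgeOneG _)).sub
      (((isHomog_compD h x).wedgeOneG _).wedgeOneG _)

/-- `b` has degree `k` if `α` has degree `k + 1`. [folklore] -/
theorem isHomog_compB {k : ℕ} {α : GForm V ℂ} (h : IsHomog (k + 1) α) (x : V) : IsHomog k (compB J x α) :=
  ((isHomog_compE h x).sub ((isHomog_compF h x).smul Complex.I)).smul _

/-- `c` has degree `k` if `α` has degree `k + 1`. [folklore] -/
theorem isHomog_compC {k : ℕ} {α : GForm V ℂ} (h : IsHomog (k + 1) α) (x : V) : IsHomog k (compC J x α) :=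
  ((isHomog_compE h x).add ((isHomog_compF h x).smul Complex.I)).smul _

end Degrees

/-! ### Supports of the components in a unitary frame -/

section Supports

variable {J} {d : ℕ} {u : Fin d → V} {S : Finset (Fin d)} {w : GForm V F}

/-- A form supported in `S` and killed by `u_n ⌟`, `Ju_n ⌟` is supported in `S.erase n`. [folklore] -/
theorem IsFrameSupported.erase (h : IsFrameSupported J u S w) {n : Fin d} (hx : GForm.curryLeftG (u n) w = 0)
    (hy : GForm.curryLeftG (J (u n)) w = 0) : IsFrameSupported J u (S.erase n) w := by
  intro a ha
  rcases eq_or_ne a n with rfl | han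
  · exact ⟨hx, hy⟩
  · exact h a fun haS ↦ ha (Finset.mem_erase.2 ⟨han, haS⟩)

variable (hJJ : ∀ v, J (J v) = -v) (hJ : ∀ v w, ⟪J v, J w⟫_ℝ = ⟪v, w⟫_ℝ) (hu : Orthonormal ℝ u)
  (huJ : ∀ i j, ⟪u i, J (u j)⟫_ℝ = 0) {n : Fin d} (hn : n ∈ S)

include hJJ hJ hu huJ hn

omit hJJ hJ hn in
/-- In a unitary frame, `⟪u_n, u_n⟫ = 1` and `⟪u_n, Ju_n⟫ = 0`. [folklore] -/
theorem frame_unit (n : Fin d) : ⟪u n, u n⟫_ℝ = 1 ∧ ⟪u n, J (u n)⟫_ℝ = 0 := by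
  refine ⟨?_, huJ n n⟩
  rw [frame_inner_u_u u hu, if_pos rfl]

omit hJJ hJ hu huJ hn in
/-- `d` is supported where `α` is. [folklore] -/
theorem isFrameSupported_compD (h : IsFrameSupported J u S w) (n : Fin d) :
    IsFrameSupported J u S (compD J (u n) w) :=
  (h.curryLeftG _).curryLeftG _

/-- `e` is supported where `α` is (`n ∈ S`). [folklore] -/
theorem isFrameSupported_compE (h : IsFrameSupported J u S w) : IsFrameSupported J u S (compE J (u n) w) :=
  (h.curryLeftG _).sub ((isFrameSupported_compD h n).wedgeOneG_coframe' hJJ hJ hu huJ hn)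

omit hJJ hJ in
/-- `f` is supported where `α` is (`n ∈ S`). [folklore] -/
theorem isFrameSupported_compF (h : IsFrameSupported J u S w) : IsFrameSupported J u S (compF J (u n) w) :=
  (h.curryLeftG _).add ((isFrameSupported_compD h n).wedgeOneG_coframe hu huJ hn)

/-- `a` is supported where `α` is (`n ∈ S`). [folklore] -/
theorem isFrameSupported_compA (h : IsFrameSupported J u S w) : IsFrameSupported J u S (compA J (u n) w) :=
  ((h.sub ((isFrameSupported_compE hJJ hJ hu huJ hn h).wedgeOneG_coframe hu huJ hn)).sub
    ((isFrameSupported_compF hu huJ hn h).wedgeOneG_coframe' hJJ hJ hu huJ hn)).sub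
    (((isFrameSupported_compD h n).wedgeOneG_coframe' hJJ hJ hu huJ hn).wedgeOneG_coframe hu huJ hn)

/-- `b` is supported where `α` is (`n ∈ S`). [folklore] -/
theorem isFrameSupported_compB {w : GForm V ℂ} (h : IsFrameSupported J u S w) :
    IsFrameSupported J u S (compB J (u n) w) :=
  ((isFrameSupported_compE hJJ hJ hu huJ hn h).sub ((isFrameSupported_compF hu huJ hn h).smul_complex _)).smul_complex _

/-- `c` is supported where `α` is (`n ∈ S`). [folklore] -/
theorem isFrameSupported_compC {w : GForm V ℂ} (h : IsFrameSupported J u S w) :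
    IsFrameSupported J u S (compC J (u n) w) :=
  ((isFrameSupported_compE hJJ hJ hu huJ hn h).add ((isFrameSupported_compF hu huJ hn h).smul_complex _)).smul_complex _

/-- **The components of a form supported in `S` are supported in `S.erase n`** (they are horizontal
for `u_n`, `Ju_n`): the version for `a`. [folklore] -/
theorem isFrameSupported_compA_erase (h : IsFrameSupported J u S w) :
    IsFrameSupported J u (S.erase n) (compA J (u n) w) := by
  obtain ⟨h1x, h0x, h0y, h1y⟩ := coframe_pairings J hJJ hJ (frame_unit hu huJ n).1 (frame_unit hu huJ n).2
  exact (isFrameSupported_compA hJJ hJ hu huJ hn h).erase (curryLeftG_compA h1x h0y w) (curryLeftG_J_compA h0x h1y w)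

omit hJJ hJ hu huJ hn in
/-- The version for `d`. [folklore] -/
theorem isFrameSupported_compD_erase (h : IsFrameSupported J u S w) (n : Fin d) :
    IsFrameSupported J u (S.erase n) (compD J (u n) w) :=
  (isFrameSupported_compD h n).erase (curryLeftG_compD (u n) w) (curryLeftG_J_compD (u n) w)

/-- The version for `b`. [folklore] -/
theorem isFrameSupported_compB_erase {w : GForm V ℂ} (h : IsFrameSupported J u S w) :
    IsFrameSupported J u (S.erase n) (compB J (u n) w) := by
  obtain ⟨h1x, h0x, h0y, h1y⟩ := coframe_pairings J hJJ hJ (frame_unit hu huJ n).1 (frame_unit hu huJ n).2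
  exact (isFrameSupported_compB hJJ hJ hu huJ hn h).erase (curryLeftG_compB h1x h0y w) (curryLeftG_J_compB h0x h1y w)

/-- The version for `c`. [folklore] -/
theorem isFrameSupported_compC_erase {w : GForm V ℂ} (h : IsFrameSupported J u S w) :
    IsFrameSupported J u (S.erase n) (compC J (u n) w) := by
  obtain ⟨h1x, h0x, h0y, h1y⟩ := coframe_pairings J hJJ hJ (frame_unit hu huJ n).1 (frame_unit hu huJ n).2
  exact (isFrameSupported_compC hJJ hJ hu huJ hn h).erase (curryLeftG_compC h1x h0y w) (curryLeftG_J_compC h0x h1y w)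

end Supports

/-! ### The Lefschetz operators of the coframe against the decomposition -/

section Lefschetz

variable {J} {d : ℕ} {u : Fin d → V}

/-- `L_{n}` is `θ_{u_n} ∧ θ_{Ju_n} ∧ ·`. [folklore] -/
theorem frameLef_singleton (n : Fin d) (w : GForm V F) :
    frameLef J u {n} w = wedgeOneG (innerSL ℝ (u n)) (wedgeOneG (innerSL ℝ (J (u n))) w) :=
  lefG_singleton_apply _ _ n w

/-- `L_S` is `ℂ`-linear. [folklore] -/
theorem frameLef_smul_complex (S : Finset (Fin d)) (c : ℂ) (w : GForm V ℂ) :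
    frameLef J u S (c • w) = c • frameLef J u S w :=
  lefG_smul_complex _ _ S c w

/-- `L_S^r` is `ℂ`-linear. [folklore] -/
theorem frameLef_pow_smul_complex (S : Finset (Fin d)) (r : ℕ) (c : ℂ) (w : GForm V ℂ) :
    (frameLef J u S ^ r) (c • w) = c • (frameLef J u S ^ r) w :=
  lefG_pow_smul_complex _ _ S r c w

/-- `L_S^r` commutes with `ζ_x ∧ ·`. [folklore] -/
theorem frameLef_pow_zetaWedgeG (S : Finset (Fin d)) (r : ℕ) (x : V) (w : GForm V ℂ) :
    (frameLef J u S ^ r) (zetaWedgeG J x w) = zetaWedgeG J x ((frameLef J u S ^ r) w) := by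
  rw [zetaWedgeG_def, zetaWedgeG_def, map_add, frameLef_pow_smul_complex, frameLef, lefG_pow_wedgeOneG,
    lefG_pow_wedgeOneG]

/-- `L_S^r` commutes with `ζ̄_x ∧ ·`. [folklore] -/
theorem frameLef_pow_zetaBarWedgeG (S : Finset (Fin d)) (r : ℕ) (x : V) (w : GForm V ℂ) :
    (frameLef J u S ^ r) (zetaBarWedgeG J x w) = zetaBarWedgeG J x ((frameLef J u S ^ r) w) := by
  rw [zetaBarWedgeG_def, zetaBarWedgeG_def, map_sub, frameLef_pow_smul_complex, frameLef, lefG_pow_wedgeOneG,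
    lefG_pow_wedgeOneG]

/-- `L_S^r` commutes with `L_T`. [folklore] -/
theorem frameLef_pow_frameLef (S T : Finset (Fin d)) (r : ℕ) (w : GForm V F) :
    (frameLef J u S ^ r) (frameLef J u T w) = frameLef J u T ((frameLef J u S ^ r) w) := by
  have h := ((commute_lefG (F := F) (fun a ↦ innerSL ℝ (u a)) (fun a ↦ innerSL ℝ (J (u a))) S T).pow_left r).eq
  exact LinearMap.congr_fun h w

/-- `L_{n}` kills `ζ_{u_n} ∧ w`. [folklore] -/
theorem frameLef_singleton_zetaWedgeG (n : Fin d) (w : GForm V ℂ) : frameLef J u {n} (zetaWedgeG J (u n) w) = 0 := by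
  rw [zetaWedgeG_def, map_add, frameLef_smul_complex, frameLef, lefG_singleton_wedgeOneG_fst,
    lefG_singleton_wedgeOneG_snd, smul_zero, add_zero]

/-- `L_{n}` kills `ζ̄_{u_n} ∧ w`. [folklore] -/
theorem frameLef_singleton_zetaBarWedgeG (n : Fin d) (w : GForm V ℂ) :
    frameLef J u {n} (zetaBarWedgeG J (u n) w) = 0 := by
  rw [zetaBarWedgeG_def, map_sub, frameLef_smul_complex, frameLef, lefG_singleton_wedgeOneG_fst,
    lefG_singleton_wedgeOneG_snd, smul_zero, sub_zero]

/-- `L_{n} L_{n} = 0`. [folklore] -/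
theorem frameLef_singleton_frameLef_singleton (n : Fin d) (w : GForm V F) :
    frameLef J u {n} (frameLef J u {n} w) = 0 := by
  have h := lefG_singleton_mul_self (F := F) (fun a ↦ innerSL ℝ (u a)) (fun a ↦ innerSL ℝ (J (u a))) n
  exact LinearMap.congr_fun h w

variable (hu : Orthonormal ℝ u) (huJ : ∀ i j, ⟪u i, J (u j)⟫_ℝ = 0)
include hu huJ

/-- For `n ∉ S`, `u_n ⌟` commutes with `L_S`. [folklore] -/
theorem curryLeftG_frameLef_of_notMem (hJJ : ∀ v, J (J v) = -v) (hJ : ∀ v w, ⟪J v, J w⟫_ℝ = ⟪v, w⟫_ℝ)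
    {S : Finset (Fin d)} {n : Fin d} (hn : n ∉ S) (w : GForm V F) :
    curryLeftG (u n) (frameLef J u S w) = frameLef J u S (curryLeftG (u n) w) := by
  rw [frameLef, lefG_apply, lefG_apply, _root_.map_sum]
  refine Finset.sum_congr rfl fun a ha ↦ ?_
  have hne : a ≠ n := fun h ↦ hn (h ▸ ha)
  rw [curryLeftG_wedgeOneG, innerSL_apply_apply, frame_inner_u_u u hu, if_neg hne, zero_smul, zero_sub,
    curryLeftG_wedgeOneG, innerSL_apply_apply, frame_inner_Ju_u J hJJ hJ u huJ, zero_smul, zero_sub, map_neg, neg_neg]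

/-- For `n ∉ S`, `Ju_n ⌟` commutes with `L_S`. [folklore] -/
theorem curryLeftG_J_frameLef_of_notMem (hJ : ∀ v w, ⟪J v, J w⟫_ℝ = ⟪v, w⟫_ℝ)
    {S : Finset (Fin d)} {n : Fin d} (hn : n ∉ S) (w : GForm V F) :
    curryLeftG (J (u n)) (frameLef J u S w) = frameLef J u S (curryLeftG (J (u n)) w) := by
  rw [frameLef, lefG_apply, lefG_apply, _root_.map_sum]
  refine Finset.sum_congr rfl fun a ha ↦ ?_
  have hne : a ≠ n := fun h ↦ hn (h ▸ ha)
  rw [curryLeftG_wedgeOneG, innerSL_apply_apply, huJ, zero_smul, zero_sub, curryLeftG_wedgeOneG,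
    innerSL_apply_apply, frame_inner_Ju_Ju J hJ u hu, if_neg hne, zero_smul, zero_sub, map_neg, neg_neg]

/-- For `n ∉ S`, `u_n ⌟` commutes with `L_S^r`. [folklore] -/
theorem curryLeftG_frameLef_pow_of_notMem (hJJ : ∀ v, J (J v) = -v) (hJ : ∀ v w, ⟪J v, J w⟫_ℝ = ⟪v, w⟫_ℝ)
    {S : Finset (Fin d)} {n : Fin d} (hn : n ∉ S) (r : ℕ) (w : GForm V F) :
    curryLeftG (u n) ((frameLef J u S ^ r) w) = (frameLef J u S ^ r) (curryLeftG (u n) w) := by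
  induction r generalizing w with
  | zero => rfl
  | succ r ih =>
    rw [pow_succ, Module.End.mul_apply, Module.End.mul_apply, ih, curryLeftG_frameLef_of_notMem hu huJ hJJ hJ hn]

/-- For `n ∉ S`, `Ju_n ⌟` commutes with `L_S^r`. [folklore] -/
theorem curryLeftG_J_frameLef_pow_of_notMem (hJ : ∀ v w, ⟪J v, J w⟫_ℝ = ⟪v, w⟫_ℝ)
    {S : Finset (Fin d)} {n : Fin d} (hn : n ∉ S) (r : ℕ) (w : GForm V F) :
    curryLeftG (J (u n)) ((frameLef J u S ^ r) w) = (frameLef J u S ^ r) (curryLeftG (J (u n)) w) := by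
  induction r generalizing w with
  | zero => rfl
  | succ r ih =>
    rw [pow_succ, Module.End.mul_apply, Module.End.mul_apply, ih, curryLeftG_J_frameLef_of_notMem hu huJ hJ hn]

end Lefschetz

/-! ### Primitivity transfer -/

section Primitive

variable {J} {d : ℕ} {u : Fin d → V} (hJJ : ∀ v, J (J v) = -v) (hJ : ∀ v w, ⟪J v, J w⟫_ℝ = ⟪v, w⟫_ℝ)
  (hu : Orthonormal ℝ u) (huJ : ∀ i j, ⟪u i, J (u j)⟫_ℝ = 0) {S' : Finset (Fin d)} {n : Fin d} (hn : n ∉ S')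

include hJJ hJ hu huJ hn

/-- **Primitivity transfer.** Let `S = insert n S'` (`n ∉ S'`), `L = L_S`, `L' = L_{S'}`, and let
`α = a + ζ ∧ b + ζ̄ ∧ c + L_{n} d` be the decomposition of `α` along `u_n`. If `L^{r+1} α = 0` then
`L'^{r+1} b = 0`, `L'^{r+1} c = 0`, `L'^{r+1} a = 0` and `L'^{r+1} d + (r+1) L'^r a = 0`:
expand `L^{r+1} = L'^{r+1} + (r+1) L_{n} L'^r` (`L_{n}² = 0`), note that `L_{n}` kills `ζ ∧`, `ζ̄ ∧`
and commutes with `L'`, and apply uniqueness of the decomposition to `L^{r+1} α = 0`.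
[cite: Huybrechts2005, Prop. 1.2.30 and Cor. 1.2.36] -/
theorem primitive_components (r : ℕ) (α : GForm V ℂ) (hα : (frameLef J u (insert n S') ^ (r + 1)) α = 0) :
    (frameLef J u S' ^ (r + 1)) (compB J (u n) α) = 0 ∧ (frameLef J u S' ^ (r + 1)) (compC J (u n) α) = 0 ∧
      (frameLef J u S' ^ (r + 1)) (compA J (u n) α) = 0 ∧
      (frameLef J u S' ^ (r + 1)) (compD J (u n) α) + (r + 1) • (frameLef J u S' ^ r) (compA J (u n) α) = 0 := by
  classical
  set x := u n with hxdef
  set L' : Module.End ℝ (GForm V ℂ) := frameLef J u S'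
  set Ln : Module.End ℝ (GForm V ℂ) := frameLef J u {n}
  set A := compA J x α
  set B := compB J x α
  set C := compC J x α
  set D := compD J x α
  obtain ⟨h1x, h0x, h0y, h1y⟩ := coframe_pairings J hJJ hJ (frame_unit hu huJ n).1 (frame_unit hu huJ n).2
  -- the binomial expansion applied to the decomposition
  have hbin : (frameLef J u (insert n S') ^ (r + 1) : Module.End ℝ (GForm V ℂ)) =
      L' ^ (r + 1) + (r + 1) • (Ln * L' ^ r) := lefG_insert_pow_succ _ _ hn r
  have hdec := decomposition_eq J x α
  rw [hbin, LinearMap.add_apply, LinearMap.smul_apply, Module.End.mul_apply] at hα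
  -- `L'^j` on the four terms
  have eL : ∀ j : ℕ, (L' ^ j) α = (L' ^ j) A + zetaWedgeG J x ((L' ^ j) B) + zetaBarWedgeG J x ((L' ^ j) C) +
      Ln ((L' ^ j) D) := by
    intro j
    conv_lhs => rw [hdec]
    rw [map_add, map_add, map_add, frameLef_pow_zetaWedgeG, frameLef_pow_zetaBarWedgeG, ← frameLef_singleton n,
      frameLef_pow_frameLef]
  -- `Ln` on such a sum keeps only the first term
  have eLn : ∀ (A' B' C' D' : GForm V ℂ), Ln (A' + zetaWedgeG J x B' + zetaBarWedgeG J x C' + Ln D') = Ln A' := by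
    intro A' B' C' D'
    rw [map_add, map_add, map_add, frameLef_singleton_zetaWedgeG, frameLef_singleton_zetaBarWedgeG,
      frameLef_singleton_frameLef_singleton, add_zero, add_zero, add_zero]
  rw [eL (r + 1), eL r, eLn] at hα
  -- regroup as a decomposition of `0`
  have key : (L' ^ (r + 1)) A + zetaWedgeG J x ((L' ^ (r + 1)) B) + zetaBarWedgeG J x ((L' ^ (r + 1)) C) +
      wedgeOneG (innerSL ℝ x) (wedgeOneG (innerSL ℝ (J x)) ((L' ^ (r + 1)) D + (r + 1) • (L' ^ r) A)) = 0 := by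
    rw [← frameLef_singleton n, map_add, map_nsmul, ← hα]
    abel
  -- horizontality of the four pieces
  have hAx : curryLeftG x ((L' ^ (r + 1)) A) = 0 := by
    rw [curryLeftG_frameLef_pow_of_notMem hu huJ hJJ hJ hn, curryLeftG_compA h1x h0y, LinearMap.map_zero]
  have hAy : curryLeftG (J x) ((L' ^ (r + 1)) A) = 0 := by
    rw [curryLeftG_J_frameLef_pow_of_notMem hu huJ hJ hn, curryLeftG_J_compA h0x h1y, LinearMap.map_zero]
  have hBx : curryLeftG x ((L' ^ (r + 1)) B) = 0 := by
    rw [curryLeftG_frameLef_pow_of_notMem hu huJ hJJ hJ hn, curryLeftG_compB h1x h0y, LinearMap.map_zero]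
  have hBy : curryLeftG (J x) ((L' ^ (r + 1)) B) = 0 := by
    rw [curryLeftG_J_frameLef_pow_of_notMem hu huJ hJ hn, curryLeftG_J_compB h0x h1y, LinearMap.map_zero]
  have hCx : curryLeftG x ((L' ^ (r + 1)) C) = 0 := by
    rw [curryLeftG_frameLef_pow_of_notMem hu huJ hJJ hJ hn, curryLeftG_compC h1x h0y, LinearMap.map_zero]
  have hCy : curryLeftG (J x) ((L' ^ (r + 1)) C) = 0 := by
    rw [curryLeftG_J_frameLef_pow_of_notMem hu huJ hJ hn, curryLeftG_J_compC h0x h1y, LinearMap.map_zero]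
  have hDx : curryLeftG x ((L' ^ (r + 1)) D + (r + 1) • (L' ^ r) A) = 0 := by
    rw [map_add, map_nsmul, curryLeftG_frameLef_pow_of_notMem hu huJ hJJ hJ hn, curryLeftG_frameLef_pow_of_notMem hu huJ hJJ hJ hn,
      curryLeftG_compD, curryLeftG_compA h1x h0y, LinearMap.map_zero, LinearMap.map_zero, smul_zero, add_zero]
  have hDy : curryLeftG (J x) ((L' ^ (r + 1)) D + (r + 1) • (L' ^ r) A) = 0 := by
    rw [map_add, map_nsmul, curryLeftG_J_frameLef_pow_of_notMem hu huJ hJ hn,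
      curryLeftG_J_frameLef_pow_of_notMem hu huJ hJ hn, curryLeftG_J_compD, curryLeftG_J_compA h0x h1y,
      LinearMap.map_zero, LinearMap.map_zero, smul_zero, add_zero]
  obtain ⟨hD, hB, hC, hA⟩ := eq_zero_of_decomposition_eq_zero J hJJ hJ (frame_unit hu huJ n).1
    (frame_unit hu huJ n).2 hAx hAy hBx hBy hCx hCy hDx hDy key
  exact ⟨hB, hC, hA, hD⟩

/-- **The corrected horizontal part `a₀ = a + (r+1)⁻¹ L' d` is `L'^r`-primitive**, and `d` is
`L'^{r+2}`-primitive. [cite: Huybrechts2005, Cor. 1.2.36] -/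
theorem primitive_compA₀ (r : ℕ) (α : GForm V ℂ) (hα : (frameLef J u (insert n S') ^ (r + 1)) α = 0) :
    (frameLef J u S' ^ r) (compA J (u n) α + ((r + 1 : ℕ) : ℝ)⁻¹ • frameLef J u S' (compD J (u n) α)) = 0 ∧
      (frameLef J u S' ^ (r + 2)) (compD J (u n) α) = 0 := by
  obtain ⟨-, -, hA, hDA⟩ := primitive_components hJJ hJ hu huJ hn r α hα
  rw [add_eq_zero_iff_eq_neg] at hDA
  set L' : Module.End ℝ (GForm V ℂ) := frameLef J u S'
  have e1 : (L' ^ r) (L' (compD J (u n) α)) = (L' ^ (r + 1)) (compD J (u n) α) := by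
    rw [pow_succ, Module.End.mul_apply]
  constructor
  · rw [map_add, map_smul, e1, hDA, smul_neg, ← Nat.cast_smul_eq_nsmul ℝ, smul_smul,
      inv_mul_cancel₀ (Nat.cast_ne_zero.2 (Nat.succ_ne_zero r)), one_smul, add_neg_cancel]
  · rw [pow_succ', Module.End.mul_apply, hDA, map_neg, map_nsmul, ← Module.End.mul_apply, ← pow_succ', hA,
      smul_zero, neg_zero]

end Primitive

end Decomposition

end Literature.Geometry.Kaehler

end
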